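import Summits.ResolutionOfSingularities.ResolutionOfSingularities.Theorems.HugDimensionClasses
import HarnessLib

/-!
# HugDimensionKernels — the PROVED kernels of the node «HugDimension» (0 sorry; route-independent, phase 1b of 3)
(decomp-res node N54, lens-4 g10, source sha256 ee3232b051ee315d; CRITIC-LEDGER row 64; vocabulary and paper proofs in
`Theorems/HugDimensionClasses`, edges to `Theses/MaxContactCut` BY NAME in `Theorems/MaxContactCutHugDimension`)

* (A) the tree's (M1⁺) port `CornerNormalFormPlus n` ALONE gives g8's valuative leaf and core-valuative leaf for every
  `k` (`valuative_of_cornerNormalFormPlus`, `coreValuative_of_cornerNormalFormPlus`);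
* the monomial class is DECIDED modulo the port `MonomialCorner` + the tree's combinatorial leaf `NoCornerTower d n,
  d ≤ 4` (`monomial_of_ports`; `monomial_of_ports'` from `CornerModel` + `TowerObstructs`);
* `GeneratorHugging ⇒ TransversalMonomial`; EXACT `ForcedTowersTerminate ⟺ NonMonomialTowersTerminate` modulo the
  decided pieces (`ftt_iff_nonMonomial`), `⟺` the two `w`-leaves modulo `CurveLaw` (`ftt_iff_leaves`, the curve leaf
  closed by `curve_of_curveLaw` through `noInfiniteDescent`); `noThreeEternal`; the tree's contact / wild / growing /
  core-germ-hugging classes reached from the restricted leaves (`contact_of_pieces`, `wild_of_pieces`,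
  `growing_of_nonMonomial`, `coreGermHugging_of_pieces`); `HuggingTowersTerminate ⟺ NonMonomialTowersTerminate`
  modulo `TransversalMonomial` + the decided pieces (`hugging_iff_nonMonomial`: THE ONE EQUIV of the node).
* The `∀ n ≥ 1` shapes of the two RESTRICTED leaves (`NoNonMonomialContactTowers`, `NoNonMonomialWildTowers`); the
  five main `∀ n ≥ 1` shapes are the route asides `MaxContactCut.NoMonomialTowers` / `NoNonMonomialTowers` /
  `NoCurveHuggingTowers` / `NoSurfaceHuggingTowers` / `NoHypersurfaceHuggingTowers`.
(Sources: BierstoneGrigorievMilmanWlodarczyk2011 §3; Blanco arXiv:0902.2887; CossartJannsenSaito2020 Thm 6.35.)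
-/

set_option autoImplicit false

open CategoryTheory AlgebraicGeometry
open Literature.AlgebraicGeometry.Resolution
open Summit.ResolutionOfSingularities.ResolutionOfSingularities.Theorems
open WeakOrderReduction ForcedTowerClasses DivergentTowerClasses MonomialTowerClasses
open Summit.ResolutionOfSingularities.ResolutionOfSingularities.Theorems.HugDimensionClasses

namespace Summit.ResolutionOfSingularities.ResolutionOfSingularities.Theorems.HugDimensionKernels

/-- **(A) one level down: the tree's (M1⁺) port gives g8's VALUATIVE leaf for every `k`** (via the tree's
exhaustive-slot kernel `transversalTowersTerminate_of_cornerNormalFormPlus`). [folklore] -/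
theorem valuative_of_cornerNormalFormPlus {n : ℕ} (hn : 1 ≤ n) (hN : CornerNormalFormPlus n) :
    ValuativeTowersTerminate n :=
  fun p hp k _ _ T g hB hD hE h =>
    transversalTowersTerminate_of_cornerNormalFormPlus hn hN p hp k T g hB hD hE h.2.2

/-- … and the tree's CORE valuative leaf (the statement of aside 31261 at marking `n`). [folklore] -/
theorem coreValuative_of_cornerNormalFormPlus {n : ℕ} (hn : 1 ≤ n) (hN : CornerNormalFormPlus n) :
    CoreValuativeTowersTerminate n :=
  fun p hp k _ _ T g hB hD hE _ _ hG =>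
    transversalTowersTerminate_of_cornerNormalFormPlus hn hN p hp k T g hB hD hE hG

/-- **(B) The monomial class is DECIDED modulo `MonomialCorner` and the combinatorial leaf.** [folklore] -/
theorem monomial_of_ports {n : ℕ} (hM : MonomialCorner n) (hC : ∀ d : ℕ, d ≤ 4 → NoCornerTower d n) :
    MonomialTowersTerminate n := by
  intro p hp k _ _ T g hB hD hE hMon
  obtain ⟨-, d, hd, ⟨c⟩⟩ := hM p hp k T g hB hD hE hMon
  exact hC d hd c

/-- … and modulo `MonomialCorner` and the tree's `CornerModel`, `TowerObstructs` outright
(`MonomialTowerClasses.noCornerTower_of_model`). [folklore] -/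
theorem monomial_of_ports' {n : ℕ} (hM : MonomialCorner n) (hR : CornerModel n) (hT : TowerObstructs n) :
    MonomialTowersTerminate n :=
  monomial_of_ports hM (noCornerTower_of_model hR hT)

/-- The structure port implies the monomialisation port. [folklore] -/
theorem transversalMonomial_of_generatorHugging {n : ℕ} (h : GeneratorHugging n) : TransversalMonomial n := by
  intro p hp k _ _ T g hB hD hE hG
  by_contra hMon
  exact hG (germHugging_of_generatorHugged (h p hp k T g hB hD hE hMon))

/-- The tree's (M1) `CornerNormalForm n` from the two g10 ports. [folklore] -/
theorem cornerNormalForm_of_ports {n : ℕ} (h₁ : TransversalMonomial n) (h₂ : MonomialCorner n) :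
    CornerNormalForm n :=
  fun p hp k _ _ T g hB hD hE hG => h₂ p hp k T g hB hD hE (h₁ p hp k T g hB hD hE hG)

/-- INCLUSION transversal ⊆ monomial (mod `TransversalMonomial`). [folklore] -/
theorem transversal_of_monomial {n : ℕ} (hTM : TransversalMonomial n) (h : MonomialTowersTerminate n) :
    TransversalTowersTerminate n :=
  fun p hp k _ _ T g hB hD hE hG => h p hp k T g hB hD hE (hTM p hp k T g hB hD hE hG)

/-- INCLUSION non-monomial ⊆ hugging (mod `TransversalMonomial`): the g10 residual is SMALLER than g9's. [folklore] -/
theorem nonMonomial_of_hugging {n : ℕ} (hTM : TransversalMonomial n) (h : HuggingTowersTerminate n) :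
    NonMonomialTowersTerminate n := by
  intro p hp k _ _ T g hB hD hE hMon
  by_cases hG : GermHugging T
  · exact h p hp k T g hB hD hE hG
  · exact hMon (hTM p hp k T g hB hD hE hG)

/-- The tower piece from the residual. [folklore] -/
theorem ftt_of_nonMonomial {n : ℕ} (hM : MonomialCorner n) (hC : ∀ d : ℕ, d ≤ 4 → NoCornerTower d n)
    (h : NonMonomialTowersTerminate n) : ForcedTowersTerminate n :=
  ftt_iff_monomial_nonMonomial.mpr ⟨monomial_of_ports hM hC, h⟩

/-- **EXACT modulo the decided piece: `ForcedTowersTerminate n ⟺ NonMonomialTowersTerminate n`.** [folklore] -/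
theorem ftt_iff_nonMonomial {n : ℕ} (hM : MonomialCorner n) (hC : ∀ d : ℕ, d ≤ 4 → NoCornerTower d n) :
    ForcedTowersTerminate n ↔ NonMonomialTowersTerminate n :=
  ⟨fun h => (allPieces_of_ftt h).2.2.2.1, ftt_of_nonMonomial hM hC⟩

/-- **(C1) The curve piece is DECIDED modulo `CurveLaw`** (the descent is done here). [folklore] -/
theorem curve_of_curveLaw {n : ℕ} (hL : CurveLaw n) : CurveHuggingTowersTerminate n := by
  intro p hp k _ _ T g hB hD hE hCu
  obtain ⟨δ, μ, hδ, hlow, hstep⟩ := hL p hp k T g hB hD hE hCu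
  exact noInfiniteDescent hδ hlow hstep

/-- **(C2) No tower has three eternal components (dim ≤ 4), modulo `EternalBound`.** [folklore] -/
theorem noThreeEternal {n : ℕ} (hE : EternalBound n) : NoTower n ThreeEternal := by
  intro p hp k _ _ T g hB hD hEm h3
  obtain ⟨j₁, j₂, j₃, h12, h13, h23, h1, h2, h3⟩ := h3
  rcases hE p hp k T g hB hD hEm j₁ j₂ j₃ h1 h2 h3 with h | h | h
  · exact h12 h
  · exact h13 h
  · exact h23 h

/-- **(C3) The tower piece from the decided pieces and the two `w`-leaves.** [folklore] -/
theorem ftt_of_leaves {n : ℕ} (hM : MonomialCorner n) (hC : ∀ d : ℕ, d ≤ 4 → NoCornerTower d n) (hL : CurveLaw n)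
    (hS : SurfaceHuggingTowersTerminate n) (hH : HypersurfaceHuggingTowersTerminate n) : ForcedTowersTerminate n :=
  ftt_of_nonMonomial hM hC (nonMonomial_of_leaves (curve_of_curveLaw hL) hS hH)

/-- **EXACT modulo the decided pieces: `ForcedTowersTerminate n ⟺ Surface-leaf ∧ Hypersurface-leaf`.** [folklore] -/
theorem ftt_iff_leaves {n : ℕ} (hM : MonomialCorner n) (hC : ∀ d : ℕ, d ≤ 4 → NoCornerTower d n) (hL : CurveLaw n) :
    ForcedTowersTerminate n ↔ SurfaceHuggingTowersTerminate n ∧ HypersurfaceHuggingTowersTerminate n :=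
  ⟨fun h => ⟨(HugDimensionClasses.leaves_of_ftt h).1, (HugDimensionClasses.leaves_of_ftt h).2.1⟩,
    fun h => ftt_of_leaves hM hC hL h.1 h.2⟩

/-- **The tree's CONTACT leaf (31571 at marking `n`) from the restricted leaf + the monomial ports.** [folklore] -/
theorem contact_of_pieces {n : ℕ} (hM : MonomialCorner n) (hC : ∀ d : ℕ, d ≤ 4 → NoCornerTower d n)
    (h : NonMonomialContactTowersTerminate n) : ContactHuggingTowersTerminate n := by
  intro p hp k _ _ T g hB hD hE hCo
  by_cases hMon : EventuallyMonomial T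
  · exact monomial_of_ports hM hC p hp k T g hB hD hE hMon
  · exact h p hp k T g hB hD hE ⟨hMon, hCo⟩

/-- **The tree's WILD leaf (31572 at marking `n`) from the restricted leaf + the monomial ports.** [folklore] -/
theorem wild_of_pieces {n : ℕ} (hM : MonomialCorner n) (hC : ∀ d : ℕ, d ≤ 4 → NoCornerTower d n)
    (h : NonMonomialWildTowersTerminate n) : WildHuggingTowersTerminate n := by
  intro p hp k _ _ T g hB hD hE hW
  by_cases hMon : EventuallyMonomial T
  · exact monomial_of_ports hM hC p hp k T g hB hD hE hMon
  · exact h p hp k T g hB hD hE ⟨hMon, hW.2⟩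

/-- Converse, port-free: the tree's contact leaf contains the restricted one. [folklore] -/
theorem nonMonomialContact_of_contact {n : ℕ} (h : ContactHuggingTowersTerminate n) :
    NonMonomialContactTowersTerminate n :=
  noTower_mono (fun _ h => h.2) h

/-- Converse modulo `TransversalMonomial`: the tree's wild leaf contains the restricted one. [folklore] -/
theorem nonMonomialWild_of_wild {n : ℕ} (hTM : TransversalMonomial n) (h : WildHuggingTowersTerminate n) :
    NonMonomialWildTowersTerminate n := by
  intro p hp k _ _ T g hB hD hE hW
  by_cases hG : GermHugging T
  · exact h p hp k T g hB hD hE ⟨hG, hW.2⟩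
  · exact hW.1 (hTM p hp k T g hB hD hE hG)

/-- The hugging piece (31570 at marking `n`) from the residual + the monomial ports. [folklore] -/
theorem hugging_of_nonMonomial {n : ℕ} (hM : MonomialCorner n) (hC : ∀ d : ℕ, d ≤ 4 → NoCornerTower d n)
    (h : NonMonomialTowersTerminate n) : HuggingTowersTerminate n :=
  huggingTowersTerminate_of_ftt (ftt_of_nonMonomial hM hC h)

/-- **EXACT at the residual level: `HuggingTowersTerminate n ⟺ NonMonomialTowersTerminate n`** modulo
`TransversalMonomial` + `MonomialCorner` + the combinatorial leaf. [folklore] -/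
theorem hugging_iff_nonMonomial {n : ℕ} (hTM : TransversalMonomial n) (hM : MonomialCorner n)
    (hC : ∀ d : ℕ, d ≤ 4 → NoCornerTower d n) : HuggingTowersTerminate n ↔ NonMonomialTowersTerminate n :=
  ⟨nonMonomial_of_hugging hTM, hugging_of_nonMonomial hM hC⟩

/-- COROLLARY of `MonomialCorner`: a residually GROWING tower is never monomial — g7's p-core leaf
`GrowingTowersTerminate` is implied by «no growing NON-MONOMIAL tower». [folklore] -/
theorem growing_of_nonMonomial {n : ℕ} (hM : MonomialCorner n)
    (h : NoTower n fun T => ¬ EventuallyMonomial T ∧ ¬ T.EventuallyStationary) : GrowingTowersTerminate n := by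
  intro p hp k _ _ T g hB hD hE hns
  by_cases hMon : EventuallyMonomial T
  · exact hns (hM p hp k T g hB hD hE hMon).1
  · exact h p hp k T g hB hD hE ⟨hMon, hns⟩

/-- COROLLARY: g8's germ-hugging leaf and the tree's CORE germ-hugging leaf from the monomial ports + residual.
[folklore] -/
theorem coreGermHugging_of_pieces {n : ℕ} (hM : MonomialCorner n) (hC : ∀ d : ℕ, d ≤ 4 → NoCornerTower d n)
    (h : NonMonomialTowersTerminate n) : CoreGermHuggingTowersTerminate n :=
  fun p hp k _ _ T g hB hD hE _ _ _ => ftt_of_nonMonomial hM hC h p hp k T g hB hD hE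


/-! ## The `∀ n ≥ 1` shapes of the two RESTRICTED leaves (the five main ones are route asides of MaxContactCut) -/

/-- The restricted CONTACT leaf in `∀ n ≥ 1` shape (non-monomial towers of the tree's contact-hugging class terminate).
STATEMENT (support). -/
def NoNonMonomialContactTowers : Prop := ∀ n : ℕ, 1 ≤ n → NonMonomialContactTowersTerminate n

/-- The restricted WILD leaf in `∀ n ≥ 1` shape. STATEMENT (support). -/
def NoNonMonomialWildTowers : Prop := ∀ n : ℕ, 1 ≤ n → NonMonomialWildTowersTerminate n


end Summit.ResolutionOfSingularities.ResolutionOfSingularities.Theorems.HugDimensionKernels
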